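/-
Copyright (c) 2026 the pub-hodgecm-mathlib formalisation cell (harness21).  Prover seat hodgecm-mathlib-K2E2-p12 (g0), Track B «K2-LIT»,
engine E2 «ThetaExhaustionByRigidity», 2026-09-03.  KERNEL module: THEOREMS ONLY (no definition, no named fact, no `sorry`, no instance, no notation).
-/
import Summits.HodgeConjecture.HodgeConjecture.Theorems.F0P2OccGenCotangentOfOccursIn   -- ★ B1′ packaging `cmFieldOf` ∕ `hermSpace3Of` ∕ `archFactorOfFrame` + the (hol ∨ antihol) twin
import HarnessLib

/-!
# K2 ∕ E2 — ORIENTED OCCURRENCE, abstract currency: an irreducible `σ` occurring EQUIVARIANTLY in the HOLOMORPHIC (resp. ANTIHOLOMORPHIC) cotangent forms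
# of a CM frame is the finite component of a HOLOMORPHIC (resp. ANTIHOLOMORPHIC) cotangent discrete `P` — the two oriented halves of ★ B1′
# `F0P2OccGenCotangentOfOccursIn.exists_cotangentType_hasFinComponent_of_occursIn_cm`

Cell hodgecm-mathlib (D-0151), FLOOR 0, Track B «K2-LIT» (21-frontier RULING «PUSH BOTH», REQUESTS l.72341), engine E2 (crux item H413 =
stmt-HodgeConjecture-24833, route `HCCMUnconditional`, no route verbs), unit ORIENT of the re-cut line `Cruxes/H413/Lines/K2_E2_ThetaExhaustionByRigidity.lean`
(dealer K2E2-plan (g0) R8 SELF-FLAG 2026-09-03T21:13:25Z; K2E2-p06 (g0) 21:19:09Z ∕ 21:23:53Z: «OR-1′ antihol receiver ∕ OR-2′ orientation lemma»).  Author K2E2-p12 (g0).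
`--supports stmt-HodgeConjecture-24833 --as helper`; THEOREMS ONLY, imports ★ `Theorems/` only.

WHY.  ★ B1′ concludes `P.IsHolCotangentAt ∨ P.IsAntiholCotangentAt` from an occurrence with values in `cohForms = holCotForms ⊔ conj holCotForms`, splitting each value
along the `⊔`.  The ORIENT unit needs the two halves SEPARATELY: a `holCotForms`-valued occurrence gives a HOLOMORPHIC `P` (the positively oriented case
`ι ∈ Φ_μ` of the theta engine ★ `exists_holTheta_atFrame_of_chiN`), a `conj holCotForms`-valued one an ANTIHOLOMORPHIC `P″` (the negatively oriented case, ★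
`F0P2tThetaOccursInGenNeg` ∕ `thetaOccursInGen_caseD`), and with the E2′∕E1′ rigidity letters these give the orientation lemma «hol `P` with finite component
`ω_H(μ,a,χ)` ⟹ `ι ∈ Φ_μ`» by `by_contra` — in ABSTRACT currency, without any literal theta FUNCTION (the function-currency road is the XL residual (α) of the
repaired E2 letter, memo `K2/K2E2-p12/g0/MISSTATED-sig_K2E2CapHolThetaWitness.K2E2-p12-g0.md` ADDENDUM 1).  Proof = ★ B1′'s proof with the `⊔`-split deleted:
J1′ ★ `exists_discreteAutomorphicRep_of_equivariant_cohForms` picks `P`, `w`, `j` with `pr_P [θ w]_j ≠ 0` and `P.HasFinComponent σ`; (D)h ★ `holCotFormSpectralProjection_holds`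
(resp. (D̄) ★ `antiholCotFormSpectralProjection_of_hol`) reads the type of `P` off the projected pair.

* §1 **`exists_isHolCotangentAt_hasFinComponent_of_occursIn_hol_cm`** — hol-valued occurrence ⟹ `∃ P, P.IsHolCotangentAt … ∧ P.HasFinComponent σ`.
* §2 **`exists_isAntiholCotangentAt_hasFinComponent_of_occursIn_antihol_cm`** — `conj holCotForms`-valued occurrence ⟹ `∃ P, P.IsAntiholCotangentAt … ∧ P.HasFinComponent σ`.
HONEST LABEL: HC_CM is proved only modulo the 7 printed citations (2 remaining named inputs: hLiu418 = stmt-HodgeConjecture-24832, h413 =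
stmt-HodgeConjecture-24833) until rung 0 closes; this file discharges no printed citation — kernel glue over ★ rows.

## References
* [Liu2021] Y. Liu, *Fourier–Jacobi cycles and arithmetic relative trace formula*, Camb. J. Math. 9 (2021) = arXiv:2102.11518: proof of Prop. 4.13 (l. 2131–2146),
  App. D Lem. D.2 (2).  [BorelJacquet1979] A. Borel, H. Jacquet, PSPM 33.1 (1979), §4.2, §4.6.  [Borel1997] A. Borel, *Automorphic forms on SL₂(ℝ)*, Thm. 2.13, §8.4.
* [BorelWallach2000] A. Borel, N. Wallach, 2nd ed. (2000), VII 2.10, 3.2.  [GelfandGraevPiatetskiShapiro1969] Ch. 1 §2.3.  [Rogawski1990] Prop. 15.2.1 (b).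
-/

set_option autoImplicit false
-- the mandated namespace has the single-problem summit's repeated segment (`HodgeConjecture.HodgeConjecture`)
set_option linter.dupNamespace false

noncomputable section

namespace Summit.HodgeConjecture.HodgeConjecture.Cruxes.H413.K2E2OccOrientedOfOccursIn

open scoped TensorProduct Matrix InnerProductSpace ENNReal ComplexOrder
open MeasureTheory
open NumberField NumberField.InfinitePlace IsDedekindDomain
open Literature.AlgebraicGeometry.ShimuraVarieties
open Literature.NumberTheory Literature.NumberTheory.Automorphic Literature.NumberTheory.Automorphic.UnitaryGroup
open Literature.NumberTheory.Automorphic.UnitaryGroup.CotangentForms (toQuotFun cmArchSection cmCompactFactor holCotForms_le_cohForms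
  holCotFormSpectralProjection antiholCotFormSpectralProjection antiholCotFormSpectralProjection_of_hol)
open Summit.HodgeConjecture.HodgeConjecture.Cruxes.H413.CohFormsCarriers
open Summit.HodgeConjecture.HodgeConjecture.Cruxes.H413.F0P3SpectralJunction
open Summit.HodgeConjecture.HodgeConjecture.Cruxes.H413.F0P3StubS5Fold (exists_ne_zero_containsForm_of_classes)
open Summit.HodgeConjecture.HodgeConjecture.Cruxes.H413.F0P3HilbertProjection (orthogonalProjectionOnto_ne_zero)
open Summit.HodgeConjecture.HodgeConjecture.Cruxes.H413.SpectrumJunction (continuous_toQuotFun)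
open Summit.HodgeConjecture.HodgeConjecture.Cruxes.H413.F0P2dSocketD (holCotFormSpectralProjection_holds)
open Summit.HodgeConjecture.HodgeConjecture.Cruxes.H413.F0P2aCohFormsContinuous (continuous_apply_of_mem_cohForms_cm)
open Summit.HodgeConjecture.HodgeConjecture.Cruxes.H413.F0P3HolProjectionReduction (compactSpace_automorphicQuotient_cm four_le_finrank_of_two_le)
open Summit.HodgeConjecture.HodgeConjecture.Cruxes.H413.F0P2OccGenCotangentOfOccursIn (cmFieldOf hermSpace3Of archFactorOfFrame)

variable (L : Type) [Field L] [NumberField L] [IsCMField L] (ι : L →+* ℂ) (H : Matrix (Fin 3) (Fin 3) L) (T : GL (Fin 3) ℂ)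
  (hT : (T : Matrix (Fin 3) (Fin 3) ℂ)ᴴ * H.map ι * (T : Matrix (Fin 3) (Fin 3) ℂ) = Literature.Geometry.ComplexHyperbolic.BallModel.J)
  (hpos : ∀ τ' : L →+* ℂ, InfinitePlace.mk τ' ≠ InfinitePlace.mk ι → (H.map τ').PosDef)

/-! ## §1 Holomorphic values ⟹ a holomorphic `P` -/

set_option synthInstance.maxHeartbeats 400000 in
set_option maxHeartbeats 8000000 in
/-- **Oriented occurrence, HOLOMORPHIC half.**  For a CM frame `(L, ι, H, T)` with `H` definite off `ι` and `[L⁺:ℚ] ≥ 2`, an automorphic measure `μ`,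
an irreducible `σ` of `U(H)(𝔸_{L⁺,f})` and a NON-ZERO `σ`-equivariant linear `θ` with values in the HOLOMORPHIC cotangent forms
`holCotForms … (cmArchSection L ι H T hT) (cmCompactFactor L ι H T hT)`: some discrete automorphic `P ≤ L²(μ)` is `IsHolCotangentAt` at the frame AND has
finite component `σ`.  J1′ ★ `exists_discreteAutomorphicRep_of_equivariant_cohForms` (compact quotient, discrete decomposition; `P`, `w`, `j`, `u ∈ P` with
`⟪u, [θ w]_j⟫ ≠ 0`, `P.HasFinComponent σ`) and (D)h ★ `holCotFormSpectralProjection_holds` (the projected pair `(pr_P[θ w]₀, pr_P[θ w]₁)` is the pair of classes of a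
holomorphic cotangent form `Ψ`, contained in `P`, non-zero at `j`).
[cite: Liu2021, proof of Prop. 4.13 (l. 2131–2146); App. D Lem. D.2 (2)] [cite: BorelJacquet1979, §4.2, §4.6] [cite: Borel1997, Thm. 2.13, §8.4] -/
theorem exists_isHolCotangentAt_hasFinComponent_of_occursIn_hol_cm (h2 : 2 ≤ Module.finrank ℚ ↥(maximalRealSubfield L))
    (μ : Measure (adelicGroupData (↥(maximalRealSubfield L)) L (IsCMField.complexConj L) 3 H).automorphicQuotient)
    [(adelicGroupData (↥(maximalRealSubfield L)) L (IsCMField.complexConj L) 3 H).IsAutomorphicMeasure μ]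
    {W : Type} [AddCommGroup W] [Module ℂ W]
    (σ : Representation ℂ ↥(finAdelic (↥(maximalRealSubfield L)) L (IsCMField.complexConj L) 3 H) W) (hirr : σ.IsIrreducible)
    (θ : W →ₗ[ℂ] ((adelicGroupData (↥(maximalRealSubfield L)) L (IsCMField.complexConj L) 3 H).Adelic → (Fin 2 → ℂ))) (hθ0 : θ ≠ 0)
    (hθA : ∀ w, θ w ∈ CotangentForms.holCotForms (↥(maximalRealSubfield L)) L (IsCMField.complexConj L) 3 H
      (cmArchSection L ι H T hT) (cmCompactFactor L ι H T hT))
    (hθσ : ∀ (g : ↥(finAdelic (↥(maximalRealSubfield L)) L (IsCMField.complexConj L) 3 H)) (w : W),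
      θ (σ g w) = rightRep (cmFieldOf L) (hermSpace3Of L ι H T hT hpos) g (θ w)) :
    ∃ P : DiscreteAutomorphicRep (adelicGroupData (↥(maximalRealSubfield L)) L (IsCMField.complexConj L) 3 H) μ,
      P.IsHolCotangentAt (cmArchSection L ι H T hT) (cmCompactFactor L ι H T hT) ∧ P.HasFinComponent σ := by
  have h4 : 4 ≤ Module.finrank ℚ L := four_le_finrank_of_two_le h2
  have hD : holCotFormSpectralProjection := holCotFormSpectralProjection_holds
  haveI : CompactSpace (adelicGroupData (↥(maximalRealSubfield L)) L (IsCMField.complexConj L) 3 H).automorphicQuotient :=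
    compactSpace_automorphicQuotient_cm hpos h2
  have hcont : ∀ f ∈ cohForms (archFactorOfFrame L ι H T hT hpos), ∀ j : Fin 2, Continuous fun x => f x j :=
    fun f hf j => continuous_apply_of_mem_cohForms_cm L ι H T hT hf j
  have hθA' : ∀ w, θ w ∈ cohForms (archFactorOfFrame L ι H T hT hpos) := fun w => holCotForms_le_cohForms (hθA w)
  -- J1′ at the packaged carriers, at the given measure
  obtain ⟨P, w, j, h, hu, hfin⟩ := exists_discreteAutomorphicRep_of_equivariant_cohForms
    (F := cmFieldOf L) (V := hermSpace3Of L ι H T hT hpos) h4 μ (archFactorOfFrame L ι H T hT hpos) hcont σ hirr θ hθσ hθA' hθ0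
  have hmem : ∀ j : Fin 2,
      MemLp (toQuotFun (adelicGroupData (↥(maximalRealSubfield L)) L (IsCMField.complexConj L) 3 H) fun x => θ w x j) 2 μ :=
    fun j => memLp_of_continuous (continuous_toQuotFun (cohForms_left_invariant_apply (archFactorOfFrame L ι H T hT hpos) (hθA' w) j)
      (hcont (θ w) (hθA' w) j))
  obtain ⟨u, huP, hne⟩ := hu
  -- (D)h on the holomorphic value `θ w` itself (no `⊔`-split)
  obtain ⟨Ψ, hΨ, hΨ', heq⟩ := hD L ι H T hT hpos h2 μ P (θ w) (hθA w) hmem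
  refine ⟨P, exists_ne_zero_containsForm_of_classes P hΨ hΨ' (fun j' => ?_) ⟨j, ?_⟩, hfin⟩
  · rw [← heq j']
    exact Submodule.starProjection_apply_mem _ _
  · rw [← heq j, Submodule.starProjection_apply]
    exact Subtype.coe_ne_coe.mpr (orthogonalProjectionOnto_ne_zero P.space ⟨u, huP, hne⟩)

/-! ## §2 Antiholomorphic values ⟹ an antiholomorphic `P` -/

set_option synthInstance.maxHeartbeats 400000 in
set_option maxHeartbeats 8000000 in
/-- **Oriented occurrence, ANTIHOLOMORPHIC half.**  The same with `θ` valued in the complex conjugates of holomorphic cotangent forms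
(`(holCotForms …).map conjFun`): some discrete `P ≤ L²(μ)` is `IsAntiholCotangentAt` at the frame with finite component `σ` ((D̄) ★
`antiholCotFormSpectralProjection_of_hol`).  This is the abstract form of the ORIENT unit's «antiholomorphic receiver» OR-1′.
[cite: Liu2021, proof of Prop. 4.13 (l. 2131–2146); App. D Lem. D.2 (2)] [cite: BorelJacquet1979, §4.2, §4.6] [cite: BorelWallach2000, VII 2.10] -/
theorem exists_isAntiholCotangentAt_hasFinComponent_of_occursIn_antihol_cm (h2 : 2 ≤ Module.finrank ℚ ↥(maximalRealSubfield L))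
    (μ : Measure (adelicGroupData (↥(maximalRealSubfield L)) L (IsCMField.complexConj L) 3 H).automorphicQuotient)
    [(adelicGroupData (↥(maximalRealSubfield L)) L (IsCMField.complexConj L) 3 H).IsAutomorphicMeasure μ]
    {W : Type} [AddCommGroup W] [Module ℂ W]
    (σ : Representation ℂ ↥(finAdelic (↥(maximalRealSubfield L)) L (IsCMField.complexConj L) 3 H) W) (hirr : σ.IsIrreducible)
    (θ : W →ₗ[ℂ] ((adelicGroupData (↥(maximalRealSubfield L)) L (IsCMField.complexConj L) 3 H).Adelic → (Fin 2 → ℂ))) (hθ0 : θ ≠ 0)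
    (hθA : ∀ w, θ w ∈ (CotangentForms.holCotForms (↥(maximalRealSubfield L)) L (IsCMField.complexConj L) 3 H
      (cmArchSection L ι H T hT) (cmCompactFactor L ι H T hT)).map (CotangentForms.conjFun (↥(maximalRealSubfield L)) L (IsCMField.complexConj L) 3 H))
    (hθσ : ∀ (g : ↥(finAdelic (↥(maximalRealSubfield L)) L (IsCMField.complexConj L) 3 H)) (w : W),
      θ (σ g w) = rightRep (cmFieldOf L) (hermSpace3Of L ι H T hT hpos) g (θ w)) :
    ∃ P : DiscreteAutomorphicRep (adelicGroupData (↥(maximalRealSubfield L)) L (IsCMField.complexConj L) 3 H) μ,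
      P.IsAntiholCotangentAt (cmArchSection L ι H T hT) (cmCompactFactor L ι H T hT) ∧ P.HasFinComponent σ := by
  have h4 : 4 ≤ Module.finrank ℚ L := four_le_finrank_of_two_le h2
  have hD' : antiholCotFormSpectralProjection := antiholCotFormSpectralProjection_of_hol holCotFormSpectralProjection_holds
  haveI : CompactSpace (adelicGroupData (↥(maximalRealSubfield L)) L (IsCMField.complexConj L) 3 H).automorphicQuotient :=
    compactSpace_automorphicQuotient_cm hpos h2
  have hcont : ∀ f ∈ cohForms (archFactorOfFrame L ι H T hT hpos), ∀ j : Fin 2, Continuous fun x => f x j :=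
    fun f hf j => continuous_apply_of_mem_cohForms_cm L ι H T hT hf j
  have hθA' : ∀ w, θ w ∈ cohForms (archFactorOfFrame L ι H T hT hpos) := fun w => Submodule.mem_sup_right (hθA w)
  obtain ⟨P, w, j, h, hu, hfin⟩ := exists_discreteAutomorphicRep_of_equivariant_cohForms
    (F := cmFieldOf L) (V := hermSpace3Of L ι H T hT hpos) h4 μ (archFactorOfFrame L ι H T hT hpos) hcont σ hirr θ hθσ hθA' hθ0
  have hmem : ∀ j : Fin 2,
      MemLp (toQuotFun (adelicGroupData (↥(maximalRealSubfield L)) L (IsCMField.complexConj L) 3 H) fun x => θ w x j) 2 μ :=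
    fun j => memLp_of_continuous (continuous_toQuotFun (cohForms_left_invariant_apply (archFactorOfFrame L ι H T hT hpos) (hθA' w) j)
      (hcont (θ w) (hθA' w) j))
  obtain ⟨u, huP, hne⟩ := hu
  obtain ⟨Ψ, hΨ, hΨ', heq⟩ := hD' L ι H T hT hpos h2 μ P (θ w) (hθA w) hmem
  refine ⟨P, exists_ne_zero_containsForm_of_classes P hΨ hΨ' (fun j' => ?_) ⟨j, ?_⟩, hfin⟩
  · rw [← heq j']
    exact Submodule.starProjection_apply_mem _ _
  · rw [← heq j, Submodule.starProjection_apply]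
    exact Subtype.coe_ne_coe.mpr (orthogonalProjectionOnto_ne_zero P.space ⟨u, huP, hne⟩)

end Summit.HodgeConjecture.HodgeConjecture.Cruxes.H413.K2E2OccOrientedOfOccursIn

end
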